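/-
Copyright (c) 2026 the pub-hodgecm-mathlib formalisation cell (harness21).  Prover seat hodgecm-mathlib-F0P2-p11 (g4), S8 dealer R90-CS-plan (g4) S8-R254 (6) ∕ S8-R257 (1) ∕ S8-R277 (1)
«=» CUT (A), 2026-09-05: FILE 2∕2 of W1 `hUNF^φ` — THE UNFOLDING ROW `hunfK` FOR A K-FINITE τ-GENERATOR GIVEN AS A FINITE SUM OF PURE TENSORS, IN THE BYTES OF RECORD (V3 FILE A
`columnsFactorisedRow_of_ports`'s binder `hunfK` :151, `{S} {T′}` implicit).  Composition of ★ p865072 (`hunfK_at_of_bounded_readings`, `hunfK_finset_sum`) per summand, ★ p864998 §2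
(archimedean reading of ANY continuous bounded `Φ_∞`), FILE 1∕2 ★ p865363 (set change of the scalar), `ε·ε = 1` and `ν𝓕 = 1`; hypothesis-first on the pure-tensor decomposition (PT).
-/
import Summits.HodgeConjecture.HodgeConjecture.Theorems.K2E1ChiUnfoldingAtKmaxPureTensorU3        -- ★ p865072 (this seat): `hunfK_at_of_bounded_readings`, `hunfK_finset_sum`
import Summits.HodgeConjecture.HodgeConjecture.Theorems.K2E1ChiArchReadingOfContinuousBoundedU3   -- ★ p864998 (K2E1-p14 (g5)): `exists_archReading_of_continuous_bounded`
import Summits.HodgeConjecture.HodgeConjecture.Theorems.K2E1ChiScalarRatioSetChange               -- ★ p865363 FILE 1∕2 (this seat): `exists_differentiableOn_scalarRatio_one_of_subsets`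
import Literature.NumberTheory.NumberFields.PlacesAboveGaloisOrbits                               -- ★ `finite_setOf_under_mem` (finitely many places above a finite set)
import Literature.NumberTheory.Rogawski1990.OneDimAutRepHArchType                                  -- ★ `OneDimAutRepH.isUnitary_bcη`; brings `OneDimAutRepH`, ★ `bcη_ideleBaseChange`
import HarnessLib

/-!
# S8 (R)′ — `K2E1ChiUnfoldingRowKFiniteU3`: THE UNFOLDING ROW `hunfK^φ` OF A K-FINITE τ-GENERATOR WRITTEN AS A FINITE SUM OF PURE TENSORS, IN THE BYTES OF RECORD (FILE 2∕2 of W1)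

Track B ∕ R90-TF, crux h413 = `stmt-HodgeConjecture-24833`, route of record `HCCMUnconditional`; cell `hodgecm-mathlib`, S8 «ContSpec-n½», sub-socket (R)′ (B ED. 7 :337), (R)′τ OF RECORD
ED. 3 (K2E2-p12 (g10)): FILE A ★ `R90S8ResGMidTauColumnsOfPortsU3 :: columnsFactorisedRow_of_ports (hμu) (hunfK) (hPreal)` applies its binder `hunfK` to the pure-block pieces of every
τ-admissible K-finite generator.  THEOREMS ONLY (no `def`, no `instance`, no notation, no named-fact hypothesis, no `sorry`; default heartbeats); lane `--supports stmt-HodgeConjecture-24833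
--as helper` (count-neutral).  CLOSES NO SOCKET.

THE MATHEMATICS ([MoeglinWaldspurger1995] II.1.6–II.1.7, IV.1.11; [Langlands1976] Appendix; [BorelJacquet1979] §4.1).  A K-finite section at a finite level is a finite sum of pure tensors
`φ = Σ_i Φ_∞^i ⊗ Φ_f^i` (letter (PT), the ∞×f factorisation — NOT in the tree for `chiSectionSpacePair` yet; displayed as the hypothesis `hPT`).  For each summand, ★ p864998 §2 reads any
continuous bounded `Φ_∞^i` on the big cell (`ω_∞^i` bounded, a.e.-strongly measurable) and ★ p865072 `hunfK_at_of_bounded_readings` unfolds `(ν𝓕)⁻¹∫_{N(𝔸)} (Φ_∞^i ⊗ Φ_f^i)_z(ι(w₀)·v·k) dν =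
c(z)·A_i(z)` at every `k ∈ K_max` from the finite readings (`ω^i`, `hΩ^i`, tokens); ★ `hunfK_finset_sum` adds the rows (§1, the dischargers' bytes: characters `(φ, ψ)`, place sets
`({w ∣ S₀}, S₀)`, factor `(ν𝓕)⁻¹`).  §2 reads §1 in the bytes of record: `(φ, ψ) := (ξ.bcη⁻¹·μω, ε_{L∕L⁺})` with `hres` from the socket's `hμω` (★ `bcη_ideleBaseChange`) and `ε·ε = 1`
(★ `quadraticHeckeCharCM_sq`, so the `ζ`-part carries the trivial character), `ν𝓕 = 1`, and the place sets moved from `({w ∣ S₀}, S₀)` to any `(S, T′)` below them (finite differences by ★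
`finite_setOf_under_mem`) by FILE 1∕2 ★ `exists_differentiableOn_scalarRatio_one_of_subsets`.
* §1 **`hunfK_at_of_pureTensorSum`** — dischargers' bytes, one `k ∈ K_max`, `φ = Σ_{i∈s} Φ_∞^i ⊗ Φ_f^i`.
* §2 HEAD **`hunfK_of_record_of_pureTensorSum`** — V3 FILE A's `hunfK` inner bytes `∀ k, adelicVal k ∈ K_max → ∃ A′, … ∫ φ_z(ι(w₀)·v·k) dν = c(S,T′; z)·A′ z` for a section `φ` with a
  pure-tensor decomposition `hPT`, at every `(S, T′)` with `S ⊆ {w ∣ S₀}`, `T′ ⊆ S₀`.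
HONEST LABEL: HC_CM is proved only modulo the 7 printed citations (2 remaining named inputs: hLiu418 = `stmt-HodgeConjecture-24832`, h413 = `stmt-HodgeConjecture-24833`) until rung 0
closes; REL ≠ ★ ≠ BUILT; after this file V3's `hunfK` binder = ★ MODULO, per pure-block piece, {(PT) the ∞×f pure-tensor decomposition of a K-finite pair section at finite level, the
finite pure-tensor readings `hΩ^i` ((W)-core), the bounded readings on `S₀`, integrability `hT hfin`, the unramified rows `hin hsp` off `S₀`}; asserts no named fact; count-neutral.

## References
* [MoeglinWaldspurger1995] C. Mœglin, J.-L. Waldspurger, *Spectral Decomposition and Eisenstein Series* (1995): II.1.6–II.1.7, IV.1.11.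
* [Langlands1976] R. P. Langlands, *On the Functional Equations Satisfied by Eisenstein Series*, LNM 544 (1976): Appendix.
* [BorelJacquet1979] A. Borel, H. Jacquet, *Automorphic forms and automorphic representations*, PSPM 33.1 (1979): §4.1.
* [Rogawski1990] J. D. Rogawski, *Automorphic Representations of Unitary Groups in Three Variables*, Ann. of Math. Stud. 123 (1990): §12.2 p. 174, §13.9 p. 229.
-/

set_option autoImplicit false
set_option linter.dupNamespace false -- the mandated namespace repeats `HodgeConjecture.HodgeConjecture`

noncomputable section

open MeasureTheory MeasureTheory.Measure NumberField NumberField.InfinitePlace IsDedekindDomain Filter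
open scoped NNReal ENNReal
open Literature.NumberTheory.Automorphic Literature.NumberTheory.Automorphic.UnitaryGroup Literature.NumberTheory.GaloisRepresentations AdelicGroupData
open Literature.NumberTheory.GaloisRepresentations.IsNonarchimedeanLocalField Literature.NumberTheory.LFunctions
open Literature.NumberTheory.Automorphic.Arthur2013.Leaves.TECR
open Literature.NumberTheory.Rogawski1990 (OneDimAutRepH)
open Literature.NumberTheory.NumberFields.EquivariantSUnit (finite_setOf_under_mem)
open Summit.HodgeConjecture.HodgeConjecture.Cruxes.H413
open Summit.HodgeConjecture.HodgeConjecture.Cruxes.H413.K2E1BorelEisensteinU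
open Summit.HodgeConjecture.HodgeConjecture.Cruxes.H413.K2E1CharacterEisensteinU3PairDefs
open Summit.HodgeConjecture.HodgeConjecture.Cruxes.H413.K2E1ChiUnfoldingAtKmaxPureTensorU3 (hunfK_at_of_bounded_readings hunfK_finset_sum)
open Summit.HodgeConjecture.HodgeConjecture.Cruxes.H413.K2E1ChiArchReadingOfContinuousBoundedU3 (exists_archReading_of_continuous_bounded)
open Summit.HodgeConjecture.HodgeConjecture.Cruxes.H413.K2E1ChiScalarRatioSetChange (exists_differentiableOn_scalarRatio_one_of_subsets)

namespace Summit.HodgeConjecture.HodgeConjecture.Cruxes.H413.K2E1ChiUnfoldingRowKFiniteU3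

variable (L : Type) [Field L] [NumberField L] [IsCMField L] (hc : IsCMField.complexConj L * IsCMField.complexConj L = 1)
  {δ : L} (hcδ : IsCMField.complexConj L δ = -δ) (hδ : δ ≠ 0) {d : ↥(maximalRealSubfield L)} (hd : δ * δ = algebraMap ↥(maximalRealSubfield L) L d)

/-! ## §1 The dischargers' bytes: `hunfK` at `k ∈ K_max` for a finite sum of pure tensors with bounded finite readings and continuous bounded archimedean factors -/

section PureTensorSum

variable [MeasurableSpace (quasiSplit (↥(maximalRealSubfield L)) L (IsCMField.complexConj L) 3).Adelic] [BorelSpace (quasiSplit (↥(maximalRealSubfield L)) L (IsCMField.complexConj L) 3).Adelic]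
  [MeasurableSpace (AdeleRing (𝓞 L) L)] [BorelSpace (AdeleRing (𝓞 L) L)]
  [MeasurableSpace (AdeleRing (𝓞 ↥(maximalRealSubfield L)) ↥(maximalRealSubfield L))] [BorelSpace (AdeleRing (𝓞 ↥(maximalRealSubfield L)) ↥(maximalRealSubfield L))]
  [MeasurableSpace (InfiniteAdeleRing L)] [BorelSpace (InfiniteAdeleRing L)]
  [MeasurableSpace (InfiniteAdeleRing ↥(maximalRealSubfield L))] [BorelSpace (InfiniteAdeleRing ↥(maximalRealSubfield L))]
  [MeasurableSpace (FiniteAdeleRing (𝓞 L) L)] [BorelSpace (FiniteAdeleRing (𝓞 L) L)]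
  [MeasurableSpace (FiniteAdeleRing (𝓞 ↥(maximalRealSubfield L)) ↥(maximalRealSubfield L))] [BorelSpace (FiniteAdeleRing (𝓞 ↥(maximalRealSubfield L)) ↥(maximalRealSubfield L))]
  [∀ v : HeightOneSpectrum (𝓞 ↥(maximalRealSubfield L)), MeasurableSpace (v.adicCompletion ↥(maximalRealSubfield L))] [∀ v : HeightOneSpectrum (𝓞 ↥(maximalRealSubfield L)), BorelSpace (v.adicCompletion ↥(maximalRealSubfield L))]
  (ν : Measure ↥(adelicUnipotent ↥(maximalRealSubfield L) L (IsCMField.complexConj L) 3)) [ν.IsHaarMeasure]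
  {𝓕 : Set ↥(adelicUnipotent ↥(maximalRealSubfield L) L (IsCMField.complexConj L) 3)} (h𝓕 : IsFundamentalDomain ↥(rationalUnipotent ↥(maximalRealSubfield L) L (IsCMField.complexConj L) 3) 𝓕 ν)
  (μE : Measure (AdeleRing (𝓞 L) L)) [μE.IsAddHaarMeasure] (μE₁ : Measure (InfiniteAdeleRing L)) [μE₁.IsAddHaarMeasure]
  (μE₂ : Measure (FiniteAdeleRing (𝓞 L) L)) [μE₂.IsAddHaarMeasure]
  (μF : Measure (AdeleRing (𝓞 ↥(maximalRealSubfield L)) ↥(maximalRealSubfield L))) [μF.IsAddHaarMeasure] (μF₁ : Measure (InfiniteAdeleRing ↥(maximalRealSubfield L))) [μF₁.IsAddHaarMeasure]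
  (μF₂ : Measure (FiniteAdeleRing (𝓞 ↥(maximalRealSubfield L)) ↥(maximalRealSubfield L))) [μF₂.IsAddHaarMeasure]
  (νv : ∀ v : HeightOneSpectrum (𝓞 ↥(maximalRealSubfield L)), Measure (v.adicCompletion ↥(maximalRealSubfield L))) [∀ v, (νv v).IsAddHaarMeasure]
  {φ : HeckeCharacter L} {ψ : HeckeCharacter ↥(maximalRealSubfield L)} (hφ : φ.IsUnitary) (hψ : (ψ * quadraticHeckeCharCM L).IsUnitary)
  (hres : ∀ x, φ (AdeleRing.ideleBaseChange ↥(maximalRealSubfield L) L x) = ψ x)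

include hd h𝓕 μE μE₁ μF μF₁ hφ hψ hres in
/-- **`hunfK` AT `k ∈ K_max` FOR A FINITE SUM OF PURE TENSORS `φ = Σ_{i∈s} Φ_∞^i ⊗ Φ_f^i`** (dischargers' bytes: characters `(φ, ψ)`, place sets `({w ∣ S₀}, S₀)`, factor `(ν𝓕)⁻¹`): each
`Φ_∞^i` continuous and bounded (its archimedean reading is ★ p864998 §2 `exists_archReading_of_continuous_bounded`), each `Φ_f^i` with bounded finite readings `ω^i` on `S₀`, spherical off
`S₀`, pure-tensor reading `hΩ^i`, integrability `hT^i hfin^i` and the unramified rows `hin^i hsp^i` — then ★ p865072 `hunfK_at_of_bounded_readings` per summand and ★ `hunfK_finset_sum`.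
[cite: MoeglinWaldspurger1995, II.1.7, IV.1.11] [cite: Langlands1976, Appendix] [cite: BorelJacquet1979, §4.1] -/
theorem hunfK_at_of_pureTensorSum {ι : Type*} (s : Finset ι) (Φinf : ι → ↥(arch (↥(maximalRealSubfield L)) L (IsCMField.complexConj L) 3 ((StdForm.antidiagonal 3).over L)) → ℂ) (Φf : ι → ↥(finAdelic (↥(maximalRealSubfield L)) L (IsCMField.complexConj L) 3 ((StdForm.antidiagonal 3).over L)) → ℂ)
    (hΦc : ∀ i ∈ s, Continuous (Φinf i)) {Minf : ι → ℝ} (hΦM : ∀ i ∈ s, ∀ y, ‖Φinf i y‖ ≤ Minf i)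
    {k : (quasiSplit (↥(maximalRealSubfield L)) L (IsCMField.complexConj L) 3).Adelic} (hk : k ∈ ((standardMaximalCompactGL 3 L).comap (adelicVal (↥(maximalRealSubfield L)) L (IsCMField.complexConj L) 3 ((StdForm.antidiagonal 3).over L)) : Subgroup (quasiSplit (↥(maximalRealSubfield L)) L (IsCMField.complexConj L) 3).Adelic))
    (S₀ : Finset (HeightOneSpectrum (𝓞 ↥(maximalRealSubfield L))))
    (hgood : ∀ v ∉ S₀, (Algebra.IsUnramifiedIn (𝓞 L) v.asIdeal ∧ Valued.v (2 : v.adicCompletion ↥(maximalRealSubfield L)) = 1 ∧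
      ∀ w : PlacesOver L v, Valued.v (algebraMap L (LocalRing L v) δ w) = 1) ∧ ∀ w : PlacesOver L v, φ.IsUnramifiedAt w.1)
    (ω : ι → ∀ v : HeightOneSpectrum (𝓞 ↥(maximalRealSubfield L)), (Fin 3 → v.adicCompletion ↥(maximalRealSubfield L)) → ℂ)
    (hωc : ∀ i ∈ s, ∀ z : ℂ, 2 < z.re → ∀ v, Continuous fun p : Fin 3 → v.adicCompletion ↥(maximalRealSubfield L) =>
      ω i v p * (((∏ w' : PlacesOver L v, max 1 (max ((normAbs (w'.1.adicCompletion L) (quadraticLocalEquiv L v (IsCMField.complexConj L) hcδ hδ (p 0, p 1) w') : ℝ≥0) : ℝ)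
              ((normAbs (w'.1.adicCompletion L) ((toLocalRing L v (p 2) * algebraMap L (LocalRing L v) δ -
                toLocalRing L v 2⁻¹ * (quadraticLocalEquiv L v (IsCMField.complexConj L) hcδ hδ (p 0, p 1) *
                  conjLocal L (IsCMField.complexConj L) v (quadraticLocalEquiv L v (IsCMField.complexConj L) hcδ hδ (p 0, p 1)))) w') : ℝ≥0) : ℝ))) : ℝ) : ℂ) ^ (-z))
    (hωm : ∀ i ∈ s, ∀ v ∈ S₀, AEStronglyMeasurable (ω i v) (Measure.pi fun _ : Fin 3 => νv v)) {Mv : ι → HeightOneSpectrum (𝓞 ↥(maximalRealSubfield L)) → ℝ} (hωb : ∀ i ∈ s, ∀ v ∈ S₀, ∀ p, ‖ω i v p‖ ≤ Mv i v)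
    (hω1 : ∀ i ∈ s, ∀ v ∉ S₀, ∀ p ∈ integralBox ↥(maximalRealSubfield L) (Fin 3) v, ω i v p = 1)
    (hΩ : ∀ i ∈ s, ∀ x : Fin 3 → FiniteAdeleRing (𝓞 ↥(maximalRealSubfield L)) ↥(maximalRealSubfield L),
      Φf i (finPart (↥(maximalRealSubfield L)) L (IsCMField.complexConj L) 3 ((StdForm.antidiagonal 3).over L) ((quasiSplit (↥(maximalRealSubfield L)) L (IsCMField.complexConj L) 3).toAdelic (weylLongU ((IsCMField.complexConj L : L ≃ₐ[↥(maximalRealSubfield L)] L) : L →+* L) (rfl : (StdForm.antidiagonal 3).over L = (StdForm.antidiagonal 3).over L)) * (((heisChart hc (((((0 : InfiniteAdeleRing L)), quadraticFiniteAdeleMap ↥(maximalRealSubfield L) L δ (x 0, x 1)) : AdeleRing (𝓞 L) L), traceZeroLine ↥(maximalRealSubfield L) L (IsCMField.complexConj L) hcδ hδ ((0, x 2) : AdeleRing (𝓞 ↥(maximalRealSubfield L)) ↥(maximalRealSubfield L)))) : ↥(adelicUnipotent ↥(maximalRealSubfield L) L (IsCMField.complexConj L) 3)) : (quasiSplit (↥(maximalRealSubfield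 L)) L (IsCMField.complexConj L) 3).Adelic)) * finPart (↥(maximalRealSubfield L)) L (IsCMField.complexConj L) 3 ((StdForm.antidiagonal 3).over L) k) = ∏ᶠ v : HeightOneSpectrum (𝓞 ↥(maximalRealSubfield L)), ω i v (fun j => x j v))
    (hT : ∀ i ∈ s, ∀ z : ℂ, 2 < z.re → Integrable (fun v : ↥(adelicUnipotent ↥(maximalRealSubfield L) L (IsCMField.complexConj L) 3) => flatSectionU (fun g : (quasiSplit (↥(maximalRealSubfield L)) L (IsCMField.complexConj L) 3).Adelic => Φinf i (archPart (↥(maximalRealSubfield L)) L (IsCMField.complexConj L) 3 ((StdForm.antidiagonal 3).over L) g) * Φf i (finPart (↥(maximalRealSubfield L)) L (IsCMField.complexConj L) 3 ((StdForm.antidiagonal 3).over L) g)) z ((quasiSplit (↥(maximalRealSubfield L)) L (IsCMField.complexConj L) 3).toAdelic (weylLongU ((IsCMField.complexConj L : L ≃ₐ[↥(maximalRealSubfield L)] L) : L →+* L) (rfl : (StdForm.antidiagonal 3).over L = (StdForm.antidiagonal 3).over L)) * ((v : (quasiSplit (↥(maximalRealSubfield L)) L (IsCMField.complexConj L) 3).Adelic)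 * k))) ν)
    (hfin : ∀ i ∈ s, ∀ z : ℂ, 2 < z.re → Integrable (fun q : FiniteAdeleRing (𝓞 L) L × FiniteAdeleRing (𝓞 ↥(maximalRealSubfield L)) ↥(maximalRealSubfield L) =>
      (Φf i (finPart (↥(maximalRealSubfield L)) L (IsCMField.complexConj L) 3 ((StdForm.antidiagonal 3).over L) ((quasiSplit (↥(maximalRealSubfield L)) L (IsCMField.complexConj L) 3).toAdelic (weylLongU ((IsCMField.complexConj L : L ≃ₐ[↥(maximalRealSubfield L)] L) : L →+* L) (rfl : (StdForm.antidiagonal 3).over L = (StdForm.antidiagonal 3).over L)) * (((heisChart hc (((((0 : InfiniteAdeleRing L)), q.1) : AdeleRing (𝓞 L) L), traceZeroLine ↥(maximalRealSubfield L) L (IsCMField.complexConj L) hcδ hδ ((0, q.2) : AdeleRing (𝓞 ↥(maximalRealSubfield L)) ↥(maximalRealSubfield L)))) : ↥(adelicUnipotent ↥(maximalRealSubfield L) L (IsCMField.complexConj L) 3)) : (quasiSplit (↥(maximalRealSubfield L)) L (IsCMField.complexConj L) 3).Adelic)) * finPart (↥(maximalRealSubfield L)) L (IsCMField.complexConj L)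 3 ((StdForm.antidiagonal 3).over L) k) * ((((∏ᶠ w : HeightOneSpectrum (𝓞 L), max 1 (max ‖((((0 : InfiniteAdeleRing L)), q.1) : AdeleRing (𝓞 L) L).2 w‖₊ ‖(heisZ (c := IsCMField.complexConj L) ((((0 : InfiniteAdeleRing L)), q.1) : AdeleRing (𝓞 L) L) ((traceZeroLine ↥(maximalRealSubfield L) L (IsCMField.complexConj L) hcδ hδ ((0, q.2) : AdeleRing (𝓞 ↥(maximalRealSubfield L)) ↥(maximalRealSubfield L)) : traceZeroAdele ↥(maximalRealSubfield L) L (IsCMField.complexConj L)) : AdeleRing (𝓞 L) L)).2 w‖₊) : ℝ≥0) : ℝ) : ℂ) ^ (-z)))) (μE₂.prod μF₂))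
    (hin : ∀ i ∈ s, ∀ z : ℂ, 2 < z.re → ∀ v ∉ S₀, ∀ w : PlacesOver L v, IsCMField.complexConj L • w.1 = w.1 →
      ((Measure.pi fun _ : Fin 3 => νv v) (integralBox ↥(maximalRealSubfield L) (Fin 3) v)).toReal⁻¹ •
          ∫ p : Fin 3 → v.adicCompletion ↥(maximalRealSubfield L),
            ω i v p * (((∏ w' : PlacesOver L v, max 1 (max ((normAbs (w'.1.adicCompletion L) (quadraticLocalEquiv L v (IsCMField.complexConj L) hcδ hδ (p 0, p 1) w') : ℝ≥0) : ℝ)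
              ((normAbs (w'.1.adicCompletion L) ((toLocalRing L v (p 2) * algebraMap L (LocalRing L v) δ -
                toLocalRing L v 2⁻¹ * (quadraticLocalEquiv L v (IsCMField.complexConj L) hcδ hδ (p 0, p 1) *
                  conjLocal L (IsCMField.complexConj L) v (quadraticLocalEquiv L v (IsCMField.complexConj L) hcδ hδ (p 0, p 1)))) w') : ℝ≥0) : ℝ))) : ℝ) : ℂ) ^ (-z)
            ∂(Measure.pi fun _ : Fin 3 => νv v) =
        (1 - φ.valueAtUniformizer w.1 * (v.residueCard : ℂ) ^ (-(2 * z))) * (1 + φ.valueAtUniformizer w.1 * (v.residueCard : ℂ) ^ (-(2 * z - 1))) /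
          ((1 - φ.valueAtUniformizer w.1 * (v.residueCard : ℂ) ^ (-(2 * z - 2))) * (1 + φ.valueAtUniformizer w.1 * (v.residueCard : ℂ) ^ (-(2 * z - 2)))))
    (hsp : ∀ i ∈ s, ∀ z : ℂ, 2 < z.re → ∀ v ∉ S₀, ∀ w : PlacesOver L v, IsCMField.complexConj L • w.1 ≠ w.1 →
      ((Measure.pi fun _ : Fin 3 => νv v) (integralBox ↥(maximalRealSubfield L) (Fin 3) v)).toReal⁻¹ •
          ∫ p : Fin 3 → v.adicCompletion ↥(maximalRealSubfield L),
            ω i v p * (((∏ w' : PlacesOver L v, max 1 (max ((normAbs (w'.1.adicCompletion L) (quadraticLocalEquiv L v (IsCMField.complexConj L) hcδ hδ (p 0, p 1) w') : ℝ≥0) : ℝ)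
              ((normAbs (w'.1.adicCompletion L) ((toLocalRing L v (p 2) * algebraMap L (LocalRing L v) δ -
                toLocalRing L v 2⁻¹ * (quadraticLocalEquiv L v (IsCMField.complexConj L) hcδ hδ (p 0, p 1) *
                  conjLocal L (IsCMField.complexConj L) v (quadraticLocalEquiv L v (IsCMField.complexConj L) hcδ hδ (p 0, p 1)))) w') : ℝ≥0) : ℝ))) : ℝ) : ℂ) ^ (-z)
            ∂(Measure.pi fun _ : Fin 3 => νv v) =
        (1 - φ.valueAtUniformizer w.1 * (v.residueCard : ℂ) ^ (-z)) * (1 - φ.valueAtUniformizer (PlacesOver.galInv (IsCMField.complexConj L) w).1 * (v.residueCard : ℂ) ^ (-z)) *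
            (1 - φ.valueAtUniformizer w.1 * φ.valueAtUniformizer (PlacesOver.galInv (IsCMField.complexConj L) w).1 * (v.residueCard : ℂ) ^ (-(2 * z - 1))) /
          ((1 - φ.valueAtUniformizer w.1 * (v.residueCard : ℂ) ^ (-(z - 1))) * (1 - φ.valueAtUniformizer (PlacesOver.galInv (IsCMField.complexConj L) w).1 * (v.residueCard : ℂ) ^ (-(z - 1))) *
            (1 - φ.valueAtUniformizer w.1 * φ.valueAtUniformizer (PlacesOver.galInv (IsCMField.complexConj L) w).1 * (v.residueCard : ℂ) ^ (-(2 * z - 2))))) :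
    ∃ A : ℂ → ℂ, DifferentiableOn ℂ A {z : ℂ | 1 < z.re} ∧ ∀ z : ℂ, 2 < z.re →
      ((ν 𝓕).toReal⁻¹ : ℝ) • ∫ v : ↥(adelicUnipotent ↥(maximalRealSubfield L) L (IsCMField.complexConj L) 3), flatSectionU (∑ i ∈ s, fun g : (quasiSplit (↥(maximalRealSubfield L)) L (IsCMField.complexConj L) 3).Adelic => Φinf i (archPart (↥(maximalRealSubfield L)) L (IsCMField.complexConj L) 3 ((StdForm.antidiagonal 3).over L) g) * Φf i (finPart (↥(maximalRealSubfield L)) L (IsCMField.complexConj L) 3 ((StdForm.antidiagonal 3).over L) g)) z ((quasiSplit (↥(maximalRealSubfield L)) L (IsCMField.complexConj L) 3).toAdelic (weylLongU ((IsCMField.complexConj L : L ≃ₐ[↥(maximalRealSubfield L)] L) : L →+* L) (rfl : (StdForm.antidiagonal 3).over L = (StdForm.antidiagonal 3).over L)) * ((v : (quasiSplit (↥(maximalRealSubfield L)) L (IsCMField.complexConj L) 3).Adelic) * k)) ∂ν =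
        ((partialStandardL {w : HeightOneSpectrum (𝓞 L) | w.under (𝓞 ↥(maximalRealSubfield L)) ∈ (↑S₀ : Set (HeightOneSpectrum (𝓞 ↥(maximalRealSubfield L))))} (fun w => {φ.valueAtUniformizer w}) (z - 1) *
            partialStandardL (↑S₀ : Set (HeightOneSpectrum (𝓞 ↥(maximalRealSubfield L)))) (fun v => {(ψ * quadraticHeckeCharCM L).valueAtUniformizer v}) (2 * z - 2)) /
          (partialStandardL {w : HeightOneSpectrum (𝓞 L) | w.under (𝓞 ↥(maximalRealSubfield L)) ∈ (↑S₀ : Set (HeightOneSpectrum (𝓞 ↥(maximalRealSubfield L))))} (fun w => {φ.valueAtUniformizer w}) z *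
            partialStandardL (↑S₀ : Set (HeightOneSpectrum (𝓞 ↥(maximalRealSubfield L)))) (fun v => {(ψ * quadraticHeckeCharCM L).valueAtUniformizer v}) (2 * z - 1))) * A z := by
  refine hunfK_finset_sum L s ν 𝓕 k (fun i => fun g : (quasiSplit (↥(maximalRealSubfield L)) L (IsCMField.complexConj L) 3).Adelic => Φinf i (archPart (↥(maximalRealSubfield L)) L (IsCMField.complexConj L) 3 ((StdForm.antidiagonal 3).over L) g) * Φf i (finPart (↥(maximalRealSubfield L)) L (IsCMField.complexConj L) 3 ((StdForm.antidiagonal 3).over L) g)) _ (fun i hi => hT i hi) fun i hi => ?_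
  obtain ⟨ωinf, hωinfm, hωinfb, harch⟩ := exists_archReading_of_continuous_bounded L hc hcδ hδ μE₁ μF₁ (Φinf i) (hΦc i hi) (hΦM i hi) k
  exact hunfK_at_of_bounded_readings L hc hcδ hδ hd ν h𝓕 μE μE₁ μE₂ μF μF₁ μF₂ νv hφ hψ hres (Φinf i) (Φf i) hk S₀ hgood (ω i) (hωc i hi) (hωm i hi) (hωb i hi) (hω1 i hi)
    ωinf hωinfm hωinfb harch (hΩ i hi) (hT i hi) (hfin i hi) (hin i hi) (hsp i hi)

end PureTensorSum

/-! ## §2 HEAD: the same row in the bytes of record — characters `(ξ.bcη⁻¹·μω, 1)`, `ν𝓕 = 1`, any place sets `(S, T′)` below `({w ∣ S₀}, S₀)` -/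

section Record

variable [MeasurableSpace (quasiSplit (↥(maximalRealSubfield L)) L (IsCMField.complexConj L) 3).Adelic] [BorelSpace (quasiSplit (↥(maximalRealSubfield L)) L (IsCMField.complexConj L) 3).Adelic]
  [MeasurableSpace (AdeleRing (𝓞 L) L)] [BorelSpace (AdeleRing (𝓞 L) L)]
  [MeasurableSpace (AdeleRing (𝓞 ↥(maximalRealSubfield L)) ↥(maximalRealSubfield L))] [BorelSpace (AdeleRing (𝓞 ↥(maximalRealSubfield L)) ↥(maximalRealSubfield L))]
  [MeasurableSpace (InfiniteAdeleRing L)] [BorelSpace (InfiniteAdeleRing L)]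
  [MeasurableSpace (InfiniteAdeleRing ↥(maximalRealSubfield L))] [BorelSpace (InfiniteAdeleRing ↥(maximalRealSubfield L))]
  [MeasurableSpace (FiniteAdeleRing (𝓞 L) L)] [BorelSpace (FiniteAdeleRing (𝓞 L) L)]
  [MeasurableSpace (FiniteAdeleRing (𝓞 ↥(maximalRealSubfield L)) ↥(maximalRealSubfield L))] [BorelSpace (FiniteAdeleRing (𝓞 ↥(maximalRealSubfield L)) ↥(maximalRealSubfield L))]
  [∀ v : HeightOneSpectrum (𝓞 ↥(maximalRealSubfield L)), MeasurableSpace (v.adicCompletion ↥(maximalRealSubfield L))] [∀ v : HeightOneSpectrum (𝓞 ↥(maximalRealSubfield L)), BorelSpace (v.adicCompletion ↥(maximalRealSubfield L))]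
  (ν : Measure ↥(adelicUnipotent ↥(maximalRealSubfield L) L (IsCMField.complexConj L) 3)) [ν.IsHaarMeasure]
  {𝓕 : Set ↥(adelicUnipotent ↥(maximalRealSubfield L) L (IsCMField.complexConj L) 3)} (h𝓕 : IsFundamentalDomain ↥(rationalUnipotent ↥(maximalRealSubfield L) L (IsCMField.complexConj L) 3) 𝓕 ν)
  (μE : Measure (AdeleRing (𝓞 L) L)) [μE.IsAddHaarMeasure] (μE₁ : Measure (InfiniteAdeleRing L)) [μE₁.IsAddHaarMeasure]
  (μE₂ : Measure (FiniteAdeleRing (𝓞 L) L)) [μE₂.IsAddHaarMeasure]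
  (μF : Measure (AdeleRing (𝓞 ↥(maximalRealSubfield L)) ↥(maximalRealSubfield L))) [μF.IsAddHaarMeasure] (μF₁ : Measure (InfiniteAdeleRing ↥(maximalRealSubfield L))) [μF₁.IsAddHaarMeasure]
  (μF₂ : Measure (FiniteAdeleRing (𝓞 ↥(maximalRealSubfield L)) ↥(maximalRealSubfield L))) [μF₂.IsAddHaarMeasure]
  (νv : ∀ v : HeightOneSpectrum (𝓞 ↥(maximalRealSubfield L)), Measure (v.adicCompletion ↥(maximalRealSubfield L))) [∀ v, (νv v).IsAddHaarMeasure]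

include hc hd h𝓕 μE μE₁ μE₂ μF μF₁ μF₂ in
/-- **HEAD — V3 FILE A's `hunfK` BYTES FOR A SECTION WITH A PURE-TENSOR DECOMPOSITION.**  For the block `(ξ, μω)` (`μω` unitary with `μω|_{𝔸_{L⁺}^×} = ε_{L∕L⁺}`, the socket's `hμω`), a
section `φ = Σ_{i∈s} Φ_∞^i ⊗ Φ_f^i` (`hPT`) with §1's per-summand data (rows `hin hsp` written with `ξ.bcη⁻¹·μω`), a Haar measure `ν` on `N(𝔸)` with `ν𝓕 = 1`, and ANY place sets
`S ⊆ {w ∣ S₀}`, `T′ ⊆ S₀`: **`∀ k, adelicVal k ∈ K_max → ∃ A′ holomorphic on {1 < Re}, ∀ z, 2 < Re z → ∫_{N(𝔸)} φ_z(ι(w₀)·v·k) dν(v) = (L^S(z−1, ξ.bcη⁻¹μω)·L^{T′}(2z−2, 1) ∕ (L^S(z, ·)·L^{T′}(2z−1, 1)))·A′ z`**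
— §1 at `(φ, ψ) := (ξ.bcη⁻¹·μω, ε)` (`hφ`: ★ `isUnitary_bcη` + `hμu`; `hψ`: `ε·ε = 1` ★ `quadraticHeckeCharCM_sq`; `hres`: ★ `bcη_ideleBaseChange` + `hμω`), `ν𝓕 = 1`, then FILE 1∕2 ★
`exists_differentiableOn_scalarRatio_one_of_subsets` (finite differences by ★ `finite_setOf_under_mem`). [cite: MoeglinWaldspurger1995, II.1.7, IV.1.11] [cite: Rogawski1990, §12.2 p. 174, §13.9 p. 229] -/
theorem hunfK_of_record_of_pureTensorSum (ξ : OneDimAutRepH L) {μω : HeckeCharacter L} (hμu : μω.IsUnitary)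
    (hμω : ∀ x : ideleGroup ↥(maximalRealSubfield L), μω (AdeleRing.ideleBaseChange (↥(maximalRealSubfield L)) L x) = quadraticHeckeCharCM L x)
    (hν1 : ν 𝓕 = 1)
    {ι : Type*} (s : Finset ι) (Φinf : ι → ↥(arch (↥(maximalRealSubfield L)) L (IsCMField.complexConj L) 3 ((StdForm.antidiagonal 3).over L)) → ℂ) (Φf : ι → ↥(finAdelic (↥(maximalRealSubfield L)) L (IsCMField.complexConj L) 3 ((StdForm.antidiagonal 3).over L)) → ℂ)
    (hΦc : ∀ i ∈ s, Continuous (Φinf i)) {Minf : ι → ℝ} (hΦM : ∀ i ∈ s, ∀ y, ‖Φinf i y‖ ≤ Minf i)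
    (φ : (quasiSplit (↥(maximalRealSubfield L)) L (IsCMField.complexConj L) 3).Adelic → ℂ) (hPT : φ = ∑ i ∈ s, fun g : (quasiSplit (↥(maximalRealSubfield L)) L (IsCMField.complexConj L) 3).Adelic => Φinf i (archPart (↥(maximalRealSubfield L)) L (IsCMField.complexConj L) 3 ((StdForm.antidiagonal 3).over L) g) * Φf i (finPart (↥(maximalRealSubfield L)) L (IsCMField.complexConj L) 3 ((StdForm.antidiagonal 3).over L) g))
    (S₀ : Finset (HeightOneSpectrum (𝓞 ↥(maximalRealSubfield L))))
    (hgood : ∀ v ∉ S₀, (Algebra.IsUnramifiedIn (𝓞 L) v.asIdeal ∧ Valued.v (2 : v.adicCompletion ↥(maximalRealSubfield L)) = 1 ∧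
      ∀ w : PlacesOver L v, Valued.v (algebraMap L (LocalRing L v) δ w) = 1) ∧ ∀ w : PlacesOver L v, (ξ.bcη⁻¹ * μω).IsUnramifiedAt w.1)
    (ω : ι → (quasiSplit (↥(maximalRealSubfield L)) L (IsCMField.complexConj L) 3).Adelic → ∀ v : HeightOneSpectrum (𝓞 ↥(maximalRealSubfield L)), (Fin 3 → v.adicCompletion ↥(maximalRealSubfield L)) → ℂ)
    (hωc : ∀ i ∈ s, ∀ k ∈ ((standardMaximalCompactGL 3 L).comap (adelicVal (↥(maximalRealSubfield L)) L (IsCMField.complexConj L) 3 ((StdForm.antidiagonal 3).over L)) : Subgroup (quasiSplit (↥(maximalRealSubfield L)) L (IsCMField.complexConj L) 3).Adelic), ∀ z : ℂ, 2 < z.re → ∀ v, Continuous fun p : Fin 3 → v.adicCompletion ↥(maximalRealSubfield L) =>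
      ω i k v p * (((∏ w' : PlacesOver L v, max 1 (max ((normAbs (w'.1.adicCompletion L) (quadraticLocalEquiv L v (IsCMField.complexConj L) hcδ hδ (p 0, p 1) w') : ℝ≥0) : ℝ)
              ((normAbs (w'.1.adicCompletion L) ((toLocalRing L v (p 2) * algebraMap L (LocalRing L v) δ -
                toLocalRing L v 2⁻¹ * (quadraticLocalEquiv L v (IsCMField.complexConj L) hcδ hδ (p 0, p 1) *
                  conjLocal L (IsCMField.complexConj L) v (quadraticLocalEquiv L v (IsCMField.complexConj L) hcδ hδ (p 0, p 1)))) w') : ℝ≥0) : ℝ))) : ℝ) : ℂ) ^ (-z))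
    (hωm : ∀ i ∈ s, ∀ k ∈ ((standardMaximalCompactGL 3 L).comap (adelicVal (↥(maximalRealSubfield L)) L (IsCMField.complexConj L) 3 ((StdForm.antidiagonal 3).over L)) : Subgroup (quasiSplit (↥(maximalRealSubfield L)) L (IsCMField.complexConj L) 3).Adelic), ∀ v ∈ S₀, AEStronglyMeasurable (ω i k v) (Measure.pi fun _ : Fin 3 => νv v)) {Mv : ι → (quasiSplit (↥(maximalRealSubfield L)) L (IsCMField.complexConj L) 3).Adelic → HeightOneSpectrum (𝓞 ↥(maximalRealSubfield L)) → ℝ} (hωb : ∀ i ∈ s, ∀ k ∈ ((standardMaximalCompactGL 3 L).comap (adelicVal (↥(maximalRealSubfield L)) L (IsCMField.complexConj L) 3 ((StdForm.antidiagonal 3).over L)) : Subgroup (quasiSplit (↥(maximalRealSubfield L)) L (IsCMField.complexConj L) 3).Adelic), ∀ v ∈ S₀, ∀ p, ‖ω i k v p‖ ≤ Mv i k v)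
    (hω1 : ∀ i ∈ s, ∀ k ∈ ((standardMaximalCompactGL 3 L).comap (adelicVal (↥(maximalRealSubfield L)) L (IsCMField.complexConj L) 3 ((StdForm.antidiagonal 3).over L)) : Subgroup (quasiSplit (↥(maximalRealSubfield L)) L (IsCMField.complexConj L) 3).Adelic), ∀ v ∉ S₀, ∀ p ∈ integralBox ↥(maximalRealSubfield L) (Fin 3) v, ω i k v p = 1)
    (hΩ : ∀ i ∈ s, ∀ k ∈ ((standardMaximalCompactGL 3 L).comap (adelicVal (↥(maximalRealSubfield L)) L (IsCMField.complexConj L) 3 ((StdForm.antidiagonal 3).over L)) : Subgroup (quasiSplit (↥(maximalRealSubfield L)) L (IsCMField.complexConj L) 3).Adelic), ∀ x : Fin 3 → FiniteAdeleRing (𝓞 ↥(maximalRealSubfield L)) ↥(maximalRealSubfield L),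
      Φf i (finPart (↥(maximalRealSubfield L)) L (IsCMField.complexConj L) 3 ((StdForm.antidiagonal 3).over L) ((quasiSplit (↥(maximalRealSubfield L)) L (IsCMField.complexConj L) 3).toAdelic (weylLongU ((IsCMField.complexConj L : L ≃ₐ[↥(maximalRealSubfield L)] L) : L →+* L) (rfl : (StdForm.antidiagonal 3).over L = (StdForm.antidiagonal 3).over L)) * (((heisChart hc (((((0 : InfiniteAdeleRing L)), quadraticFiniteAdeleMap ↥(maximalRealSubfield L) L δ (x 0, x 1)) : AdeleRing (𝓞 L) L), traceZeroLine ↥(maximalRealSubfield L) L (IsCMField.complexConj L) hcδ hδ ((0, x 2) : AdeleRing (𝓞 ↥(maximalRealSubfield L)) ↥(maximalRealSubfield L)))) : ↥(adelicUnipotent ↥(maximalRealSubfield L) L (IsCMField.complexConj L) 3)) : (quasiSplit (↥(maximalRealSubfield L)) L (IsCMField.complexConj L) 3).Adelic)) * finPart (↥(maximalRealSubfield L)) L (IsCMField.complexConj L) 3 ((StdForm.antidiagonal 3).over L) k) = ∏ᶠ v : HeightOneSpectrum (𝓞 ↥(maximalRealSubfield L)), ω i k v (fun j => x j v))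
    (hT : ∀ i ∈ s, ∀ k ∈ ((standardMaximalCompactGL 3 L).comap (adelicVal (↥(maximalRealSubfield L)) L (IsCMField.complexConj L) 3 ((StdForm.antidiagonal 3).over L)) : Subgroup (quasiSplit (↥(maximalRealSubfield L)) L (IsCMField.complexConj L) 3).Adelic), ∀ z : ℂ, 2 < z.re → Integrable (fun v : ↥(adelicUnipotent ↥(maximalRealSubfield L) L (IsCMField.complexConj L) 3) => flatSectionU (fun g : (quasiSplit (↥(maximalRealSubfield L)) L (IsCMField.complexConj L) 3).Adelic => Φinf i (archPart (↥(maximalRealSubfield L)) L (IsCMField.complexConj L) 3 ((StdForm.antidiagonal 3).over L) g) * Φf i (finPart (↥(maximalRealSubfield L)) L (IsCMField.complexConj L) 3 ((StdForm.antidiagonal 3).over L) g)) z ((quasiSplit (↥(maximalRealSubfield L)) L (IsCMField.complexConj L) 3).toAdelic (weylLongU ((IsCMField.complexConj L : L ≃ₐ[↥(maximalRealSubfield L)] L) : L →+* L) (rfl : (StdForm.antidiagonal 3).over L = (StdForm.antidiagonal 3).over L)) * ((v : (quasiSplit (↥(maximalRealSubfield L)) L (IsCMField.complexConj L) 3).Adelic)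 * k))) ν)
    (hfin : ∀ i ∈ s, ∀ k ∈ ((standardMaximalCompactGL 3 L).comap (adelicVal (↥(maximalRealSubfield L)) L (IsCMField.complexConj L) 3 ((StdForm.antidiagonal 3).over L)) : Subgroup (quasiSplit (↥(maximalRealSubfield L)) L (IsCMField.complexConj L) 3).Adelic), ∀ z : ℂ, 2 < z.re → Integrable (fun q : FiniteAdeleRing (𝓞 L) L × FiniteAdeleRing (𝓞 ↥(maximalRealSubfield L)) ↥(maximalRealSubfield L) =>
      (Φf i (finPart (↥(maximalRealSubfield L)) L (IsCMField.complexConj L) 3 ((StdForm.antidiagonal 3).over L) ((quasiSplit (↥(maximalRealSubfield L)) L (IsCMField.complexConj L) 3).toAdelic (weylLongU ((IsCMField.complexConj L : L ≃ₐ[↥(maximalRealSubfield L)] L) : L →+* L) (rfl : (StdForm.antidiagonal 3).over L = (StdForm.antidiagonal 3).over L)) * (((heisChart hc (((((0 : InfiniteAdeleRing L)), q.1) : AdeleRing (𝓞 L) L), traceZeroLine ↥(maximalRealSubfield L) L (IsCMField.complexConj L) hcδ hδ ((0, q.2) : AdeleRing (𝓞 ↥(maximalRealSubfield L)) ↥(maximalRealSubfield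 L)))) : ↥(adelicUnipotent ↥(maximalRealSubfield L) L (IsCMField.complexConj L) 3)) : (quasiSplit (↥(maximalRealSubfield L)) L (IsCMField.complexConj L) 3).Adelic)) * finPart (↥(maximalRealSubfield L)) L (IsCMField.complexConj L) 3 ((StdForm.antidiagonal 3).over L) k) * ((((∏ᶠ w : HeightOneSpectrum (𝓞 L), max 1 (max ‖((((0 : InfiniteAdeleRing L)), q.1) : AdeleRing (𝓞 L) L).2 w‖₊ ‖(heisZ (c := IsCMField.complexConj L) ((((0 : InfiniteAdeleRing L)), q.1) : AdeleRing (𝓞 L) L) ((traceZeroLine ↥(maximalRealSubfield L) L (IsCMField.complexConj L) hcδ hδ ((0, q.2) : AdeleRing (𝓞 ↥(maximalRealSubfield L)) ↥(maximalRealSubfield L)) : traceZeroAdele ↥(maximalRealSubfield L) L (IsCMField.complexConj L)) : AdeleRing (𝓞 L) L)).2 w‖₊) : ℝ≥0) : ℝ) : ℂ) ^ (-z)))) (μE₂.prod μF₂))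
    (hin : ∀ i ∈ s, ∀ k ∈ ((standardMaximalCompactGL 3 L).comap (adelicVal (↥(maximalRealSubfield L)) L (IsCMField.complexConj L) 3 ((StdForm.antidiagonal 3).over L)) : Subgroup (quasiSplit (↥(maximalRealSubfield L)) L (IsCMField.complexConj L) 3).Adelic), ∀ z : ℂ, 2 < z.re → ∀ v ∉ S₀, ∀ w : PlacesOver L v, IsCMField.complexConj L • w.1 = w.1 →
      ((Measure.pi fun _ : Fin 3 => νv v) (integralBox ↥(maximalRealSubfield L) (Fin 3) v)).toReal⁻¹ •
          ∫ p : Fin 3 → v.adicCompletion ↥(maximalRealSubfield L),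
            ω i k v p * (((∏ w' : PlacesOver L v, max 1 (max ((normAbs (w'.1.adicCompletion L) (quadraticLocalEquiv L v (IsCMField.complexConj L) hcδ hδ (p 0, p 1) w') : ℝ≥0) : ℝ)
              ((normAbs (w'.1.adicCompletion L) ((toLocalRing L v (p 2) * algebraMap L (LocalRing L v) δ -
                toLocalRing L v 2⁻¹ * (quadraticLocalEquiv L v (IsCMField.complexConj L) hcδ hδ (p 0, p 1) *
                  conjLocal L (IsCMField.complexConj L) v (quadraticLocalEquiv L v (IsCMField.complexConj L) hcδ hδ (p 0, p 1)))) w') : ℝ≥0) : ℝ))) : ℝ) : ℂ) ^ (-z)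
            ∂(Measure.pi fun _ : Fin 3 => νv v) =
        (1 - (ξ.bcη⁻¹ * μω).valueAtUniformizer w.1 * (v.residueCard : ℂ) ^ (-(2 * z))) * (1 + (ξ.bcη⁻¹ * μω).valueAtUniformizer w.1 * (v.residueCard : ℂ) ^ (-(2 * z - 1))) /
          ((1 - (ξ.bcη⁻¹ * μω).valueAtUniformizer w.1 * (v.residueCard : ℂ) ^ (-(2 * z - 2))) * (1 + (ξ.bcη⁻¹ * μω).valueAtUniformizer w.1 * (v.residueCard : ℂ) ^ (-(2 * z - 2)))))
    (hsp : ∀ i ∈ s, ∀ k ∈ ((standardMaximalCompactGL 3 L).comap (adelicVal (↥(maximalRealSubfield L)) L (IsCMField.complexConj L) 3 ((StdForm.antidiagonal 3).over L)) : Subgroup (quasiSplit (↥(maximalRealSubfield L)) L (IsCMField.complexConj L) 3).Adelic), ∀ z : ℂ, 2 < z.re → ∀ v ∉ S₀, ∀ w : PlacesOver L v, IsCMField.complexConj L • w.1 ≠ w.1 →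
      ((Measure.pi fun _ : Fin 3 => νv v) (integralBox ↥(maximalRealSubfield L) (Fin 3) v)).toReal⁻¹ •
          ∫ p : Fin 3 → v.adicCompletion ↥(maximalRealSubfield L),
            ω i k v p * (((∏ w' : PlacesOver L v, max 1 (max ((normAbs (w'.1.adicCompletion L) (quadraticLocalEquiv L v (IsCMField.complexConj L) hcδ hδ (p 0, p 1) w') : ℝ≥0) : ℝ)
              ((normAbs (w'.1.adicCompletion L) ((toLocalRing L v (p 2) * algebraMap L (LocalRing L v) δ -
                toLocalRing L v 2⁻¹ * (quadraticLocalEquiv L v (IsCMField.complexConj L) hcδ hδ (p 0, p 1) *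
                  conjLocal L (IsCMField.complexConj L) v (quadraticLocalEquiv L v (IsCMField.complexConj L) hcδ hδ (p 0, p 1)))) w') : ℝ≥0) : ℝ))) : ℝ) : ℂ) ^ (-z)
            ∂(Measure.pi fun _ : Fin 3 => νv v) =
        (1 - (ξ.bcη⁻¹ * μω).valueAtUniformizer w.1 * (v.residueCard : ℂ) ^ (-z)) * (1 - (ξ.bcη⁻¹ * μω).valueAtUniformizer (PlacesOver.galInv (IsCMField.complexConj L) w).1 * (v.residueCard : ℂ) ^ (-z)) *
            (1 - (ξ.bcη⁻¹ * μω).valueAtUniformizer w.1 * (ξ.bcη⁻¹ * μω).valueAtUniformizer (PlacesOver.galInv (IsCMField.complexConj L) w).1 * (v.residueCard : ℂ) ^ (-(2 * z - 1))) /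
          ((1 - (ξ.bcη⁻¹ * μω).valueAtUniformizer w.1 * (v.residueCard : ℂ) ^ (-(z - 1))) * (1 - (ξ.bcη⁻¹ * μω).valueAtUniformizer (PlacesOver.galInv (IsCMField.complexConj L) w).1 * (v.residueCard : ℂ) ^ (-(z - 1))) *
            (1 - (ξ.bcη⁻¹ * μω).valueAtUniformizer w.1 * (ξ.bcη⁻¹ * μω).valueAtUniformizer (PlacesOver.galInv (IsCMField.complexConj L) w).1 * (v.residueCard : ℂ) ^ (-(2 * z - 2)))))
    {S : Set (HeightOneSpectrum (𝓞 L))} {T' : Set (HeightOneSpectrum (𝓞 ↥(maximalRealSubfield L)))} (hS : S ⊆ {w : HeightOneSpectrum (𝓞 L) | w.under (𝓞 ↥(maximalRealSubfield L)) ∈ (↑S₀ : Set (HeightOneSpectrum (𝓞 ↥(maximalRealSubfield L))))})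
    (hT' : T' ⊆ (↑S₀ : Set (HeightOneSpectrum (𝓞 ↥(maximalRealSubfield L))))) :
    ∀ k : (quasiSplit (↥(maximalRealSubfield L)) L (IsCMField.complexConj L) 3).Adelic, adelicVal (↥(maximalRealSubfield L)) L (IsCMField.complexConj L) 3 ((StdForm.antidiagonal 3).over L) k ∈ standardMaximalCompactGL 3 L →
      ∃ A' : ℂ → ℂ, DifferentiableOn ℂ A' {z : ℂ | 1 < z.re} ∧ ∀ z : ℂ, 2 < z.re →
        (∫ v : ↥(adelicUnipotent (↥(maximalRealSubfield L)) L (IsCMField.complexConj L) 3), flatSectionU φ z ((quasiSplit (↥(maximalRealSubfield L)) L (IsCMField.complexConj L) 3).toAdelic (weylLongU ((IsCMField.complexConj L : L ≃ₐ[↥(maximalRealSubfield L)] L) : L →+* L) (rfl : (StdForm.antidiagonal 3).over L = (StdForm.antidiagonal 3).over L)) * ((v : (quasiSplit (↥(maximalRealSubfield L)) L (IsCMField.complexConj L) 3).Adelic) * k)) ∂ν) =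
          ((partialStandardL S (fun w => {(ξ.bcη⁻¹ * μω).valueAtUniformizer w}) (z - 1) * partialStandardL T' (fun v => {(1 : HeckeCharacter ↥(maximalRealSubfield L)).valueAtUniformizer v}) (2 * z - 2)) / (partialStandardL S (fun w => {(ξ.bcη⁻¹ * μω).valueAtUniformizer w}) z * partialStandardL T' (fun v => {(1 : HeckeCharacter ↥(maximalRealSubfield L)).valueAtUniformizer v}) (2 * z - 1))) * A' z := by
  intro k hk
  have hk' : k ∈ ((standardMaximalCompactGL 3 L).comap (adelicVal (↥(maximalRealSubfield L)) L (IsCMField.complexConj L) 3 ((StdForm.antidiagonal 3).over L)) : Subgroup (quasiSplit (↥(maximalRealSubfield L)) L (IsCMField.complexConj L) 3).Adelic) := Subgroup.mem_comap.mpr hk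
  have hφu : (ξ.bcη⁻¹ * μω).IsUnitary := (OneDimAutRepH.isUnitary_bcη ξ).inv.mul hμu
  have hqq : quadraticHeckeCharCM L * quadraticHeckeCharCM L = 1 := by rw [← sq]; exact quadraticHeckeCharCM_sq L
  have hψu : (quadraticHeckeCharCM L * quadraticHeckeCharCM L).IsUnitary := by rw [hqq]; exact HeckeCharacter.isUnitary_one
  have hres : ∀ x : ideleGroup ↥(maximalRealSubfield L), (ξ.bcη⁻¹ * μω) (AdeleRing.ideleBaseChange (↥(maximalRealSubfield L)) L x) = quadraticHeckeCharCM L x := fun x => by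
    rw [HeckeCharacter.mul_apply, HeckeCharacter.inv_apply, OneDimAutRepH.bcη_ideleBaseChange, inv_one, one_mul, hμω x]
  obtain ⟨A, hA, hrow⟩ := hunfK_at_of_pureTensorSum L hc hcδ hδ hd ν h𝓕 μE μE₁ μE₂ μF μF₁ μF₂ νv hφu hψu hres s Φinf Φf hΦc hΦM hk' S₀ hgood (fun i => ω i k)
    (fun i hi => hωc i hi k hk') (fun i hi => hωm i hi k hk') (Mv := fun i => Mv i k) (fun i hi => hωb i hi k hk') (fun i hi => hω1 i hi k hk') (fun i hi => hΩ i hi k hk')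
    (fun i hi => hT i hi k hk') (fun i hi => hfin i hi k hk') (fun i hi => hin i hi k hk') (fun i hi => hsp i hi k hk')
  have hfinS : ({w : HeightOneSpectrum (𝓞 L) | w.under (𝓞 ↥(maximalRealSubfield L)) ∈ (↑S₀ : Set (HeightOneSpectrum (𝓞 ↥(maximalRealSubfield L))))} \ S).Finite :=
    (finite_setOf_under_mem (↥(maximalRealSubfield L)) L S₀.finite_toSet).subset fun w hw => hw.1
  have hfinT : ((↑S₀ : Set (HeightOneSpectrum (𝓞 ↥(maximalRealSubfield L)))) \ T').Finite := S₀.finite_toSet.subset fun v hv => hv.1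
  refine exists_differentiableOn_scalarRatio_one_of_subsets hφu hS hfinS hT' hfinT
    (fun z => ∫ v : ↥(adelicUnipotent (↥(maximalRealSubfield L)) L (IsCMField.complexConj L) 3), flatSectionU φ z ((quasiSplit (↥(maximalRealSubfield L)) L (IsCMField.complexConj L) 3).toAdelic (weylLongU ((IsCMField.complexConj L : L ≃ₐ[↥(maximalRealSubfield L)] L) : L →+* L) (rfl : (StdForm.antidiagonal 3).over L = (StdForm.antidiagonal 3).over L)) * ((v : (quasiSplit (↥(maximalRealSubfield L)) L (IsCMField.complexConj L) 3).Adelic) * k)) ∂ν) ⟨A, hA, fun z hz => ?_⟩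
  have h := hrow z hz
  rw [hν1, ENNReal.toReal_one, inv_one, one_smul, hqq] at h
  rw [hPT]
  exact h

end Record

end Summit.HodgeConjecture.HodgeConjecture.Cruxes.H413.K2E1ChiUnfoldingRowKFiniteU3

end
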